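import Summits.HodgeConjecture.HodgeConjecture.Theorems.K2E1PacketRigidityU3Defs          -- ★ p854904 (FROZEN, the negative edge): `LawfulPacketKitU3`, `PacketRigidityExhaustionAt∕U3`, `memberRigidity_of_lawful_of_exhaustion_of_rigidity`; brings ★ `LocalPacketKit`, ★ `GlobalPacket`, ★ counting layer
import Summits.HodgeConjecture.HodgeConjecture.Theorems.K2E1SingletonPacketKitSplitPlaces   -- ★ `LawfulPacketKitAt L v 𝔨` (the per-place conjunct of ★ `LawfulPacketKitU3`), `lawfulAt_singletonKit`
import Literature.NumberTheory.GaloisRepresentations.FrobeniusDensityTheorem                -- ★ `finite_setOf_not_isUnramifiedIn (M N)` («only finitely many primes ramify»; already in the import closure of the two files above — weight 0)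
import HarnessLib

/-!
# K2·E1 — DEFS LEAF `K2E1PacketRigidityU3DefsG`: the HUR-GUARDED twin of ★ `K2E1PacketRigidityU3Defs` — lawful packet kits with the unramified-member law (ℓ4)
# demanded only at the places of `L⁺` UNRAMIFIED in `L`, the named print input «PACKET RIGIDITY + EXHAUSTION» over such kits, and the repaired socket re-certified from it

Track B ∕ K2-LIT, crux h413 = `stmt-HodgeConjecture-24833`, route of record `HCCMUnconditional`; cell `hodgecm-mathlib`, squad K2; prover seat `hodgecm-mathlib-K2E1-p14` (g3),
E1 DEAL (F13-G) of R90-TF LEAD K2E1-plan (g8), LEAD #37 (A) 2026-09-04T23:12:57Z (asked by heir LEAD F0P3a-plan (g22) T21-09 (ii); S8 dealer R90-CS-plan (g2) S8-R111); lane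
`--supports stmt-HodgeConjecture-24833 --as helper` (count-neutral).  ONE NEW ADDITIVE FILE: the old ★ `K2E1PacketRigidityU3Defs` (p854904) stays FROZEN as the negative edge and is
not re-edited; same namespace `…Cruxes.H413.K2E1PacketRigidityU3`.  DEFS (`Prop`s with `Iff.rfl` read-backs) + monotonicity from the ★ unguarded notions + ONE re-certified reduction;
no instance, no notation, no axiom, no `sorry`.

## The standing defect M-159 «JQ-RAM» and its repair (director s2022; signatures S4-R14 ∕ R90-CS-audit1 F-RAM f89fd076895a36fe, REF5 R5-371 9a964df4f70dfeaf, LEAD #36 (A), LEAD #37 (A))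
★ `LawfulPacketKitU3 L 𝔩` (:78) demands (ℓ4) ★ `UnramLaw` — «the unramified packet has a `K_v`-spherical member `sph P`, it is the only `K_v`-spherical member, `⟨1, π_v⁰⟩ = ⟨ρ_v, π_v⁰⟩ = 1`»
— at EVERY finite place `v` of `L⁺`, including the (finitely many) places ramified in `L` (odd and dyadic), where print asserts no such thing: its unramified-member statements are made
for `v` unramified in `E` ([Rogawski1990, §13.1 Prop. 13.1.3 (c) p. 199; §13.3 p. 203 «`π_v` is the unique unramified member of `Π_v`»; §13.8 p. 216 last ¶ «If `v` is finite and unramified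
in `E` and `θ_v` is unramified, then …»; §4.5]).  So the ∃-witness of ★ `PacketRigidityExhaustionAt` is asked to satisfy a law print does not supply at ramified `v`.  THE REPAIR (F13
grammar, byte-identical to S4's guard in `Cruxes/H413/Lines/R90_S4_LocalKitExportA.lean` A ED. 3 v3.1 :208): guard (ℓ4) by `Algebra.IsUnramifiedIn (𝓞 L) v.asIdeal →`; (ℓ1) ★ `CardLaw`
and (ℓ5) «the unramified member lies in no other packet» stay unguarded (at a place where no packet is `unr`, (ℓ5) is vacuous).  The consumers lose nothing: member-level rigidity
(§3) uses (ℓ5) only, and (ℓ4)-consumers that need «almost every `v`» get the cofinite set BY NAME from ★ `Literature.NumberTheory.GaloisRepresentations.finite_setOf_not_isUnramifiedIn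
(↥(maximalRealSubfield L)) L` (`LawfulPacketKitU3G.eventually_unramLaw`); consumers carrying a finite `S ⊇ Ram(L∕L⁺)` use `LawfulPacketKitU3G.unramLaw` under `hS : ∀ v ∉ S, HUR v`.

## Contents
§1 `LawfulPacketKitAtG L v 𝔨` ((ℓ1) ∧ (HUR → (ℓ4)) ∧ (ℓ5)), `LawfulPacketKitU3G L 𝔩 := ∀ v, LawfulPacketKitAtG L v (𝔩 v)`; `Iff.rfl` read-backs; monotonicity `LawfulPacketKitAt.toG`-type lemmas
   `lawfulPacketKitAtG_of_lawfulAt`, `LawfulPacketKitU3.toG` (so ★ `K2E1SingletonPacketKitSplitPlaces`' lawfulness transfers for free); the (ℓ4) exports `LawfulPacketKitU3G.unramLaw`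
   (one place, under HUR), `LawfulPacketKitU3G.unramLaw_of_not_mem` (finite `S` with `∀ v ∉ S, HUR v`), `LawfulPacketKitU3G.eventually_unramLaw` (a.e. `v`, by ★ `finite_setOf_not_isUnramifiedIn`).
§2 `PacketRigidityExhaustionAtG L` (★ :92–:100's body VERBATIM with `LawfulPacketKitU3G` for `LawfulPacketKitU3`), the binder-less `PacketRigidityExhaustionU3G`; `Iff.rfl` read-backs;
   `PacketRigidityExhaustionAt.toG`, `PacketRigidityExhaustionU3.toG`.
§3 THE ONE RE-CERT `memberRigidity_of_lawfulG_of_exhaustion_of_rigidity` (★ :128–:155's statement over `(hlaw : LawfulPacketKitU3G L 𝔩)`; the a.e. step uses (ℓ5) = `(hlaw v).2.2`, exactly as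
   ★ :152 does, so no third cofinite set is needed) and `sig_K2E1RigidityFiniteU3R_of_packetRigidityExhaustionG : PacketRigidityExhaustionU3G → ‹type of sig_K2E1RigidityFiniteU3R›`
   (★ :162's road verbatim over §3, through ★ `finite_setOf_occurs_and_eqOff_of_memberRigidity`).
HONEST LABEL: HC_CM is proved only modulo the 7 printed citations (2 remaining named inputs: hLiu418 = `stmt-HodgeConjecture-24832`, h413 = `stmt-HodgeConjecture-24833`) until rung 0
closes; this file ASSERTS nothing: it NAMES one printed input as a `Prop` (now with print's own scope on (ℓ4)) and proves the repaired socket FROM it; M-159 stands until F13 (incl. this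
twin's consumers) is BUILT; REL ≠ ★ ≠ BUILT.

References: [Rogawski1990] §4.5; §13.1 Thm. 13.1.1, Prop. 13.1.2 (a) p. 198, Prop. 13.1.3 (c)(d) p. 199; §13.3 p. 201 ¶2, Thm. 13.3.5 p. 202, Thm. 13.3.6 (c) p. 202, p. 203; §13.8 p. 216, p. 219;
[FlathCorvallis1979] Thm. 3; [BorelJacquet1979] §4.6.
GATE NOTE: as in ★ `K2E1PacketRigidityU3Defs`, the docstring of the binder-less `def … : Prop` (`PacketRigidityExhaustionU3G`) spells its locators `(print: …)` so the gate's inline-fact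
relocation does not lift a route-posited statement over Summits-side vocabulary into `Literature/Uncategorized/`; predicates and theorems keep `[cite:]`.
-/

set_option autoImplicit false
-- the mandated namespace repeats the single-problem summit's segment (`HodgeConjecture.HodgeConjecture`)
set_option linter.dupNamespace false

noncomputable section

open NumberField IsDedekindDomain MeasureTheory Filter
open scoped Matrix MatrixGroups
open Literature.NumberTheory.Rogawski1990 Literature.NumberTheory.Automorphic Literature.NumberTheory.Automorphic.UnitaryGroup
open Literature.NumberTheory.GaloisRepresentations (finite_setOf_not_isUnramifiedIn)
open Summit.HodgeConjecture.HodgeConjecture.Cruxes.H413.F0P3LocalPacketKit (LocalPacketKit)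
open Summit.HodgeConjecture.HodgeConjecture.Cruxes.H413.F0P3GlobalPacket (GlobalPacket)
open Summit.HodgeConjecture.HodgeConjecture.Cruxes.H413.F0P3GlobalPacketDiscrete (cmOccursInDiscreteSpectrum)
open Summit.HodgeConjecture.HodgeConjecture.Cruxes.H413.K2E1RigidityFiniteU3R (finite_setOf_occurs_and_eqOff_of_memberRigidity)
open Summit.HodgeConjecture.HodgeConjecture.Cruxes.H413.K2E1SingletonPacketKit (LawfulPacketKitAt)

namespace Summit.HodgeConjecture.HodgeConjecture.Cruxes.H413.K2E1PacketRigidityU3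

/-! ## §1 HUR-guarded lawful packet kits on `U(Φ₃)(L⁺_v)` [Prop. 13.1.2 (a); Prop. 13.1.3 (c)(d) p. 199; p. 201 ¶2; p. 203; §13.8 p. 216] -/

section Laws

variable (L : Type) [Field L] [NumberField L] [IsCMField L]

/-- **`LawfulPacketKitAtG L v 𝔨` — the laws of Rogawski's partition `Π′(G_v)` at ONE finite place `v` of `L⁺`, with the unramified-member law guarded by «`v` is unramified in `L`»**
(guard token byte-identical to S4's `R90_S4_LocalKitExportA` A ED. 3 v3.1 :208): (ℓ1) ★ `CardLaw` [Prop. 13.1.2 (a) p. 198; p. 199]; (HUR → ℓ4) `Algebra.IsUnramifiedIn (𝓞 L) v.asIdeal → UnramLaw`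
— print's unramified-member statements are made at `v` unramified in `E` [Prop. 13.1.3 (c) p. 199; p. 203; §13.8 p. 216 last ¶]; (ℓ5) «the unramified member `sph P` of an `unr` packet lies in
NO OTHER packet» [p. 199 «in at most one unless `π = πˢ(ξ)`», `πˢ(ξ)` supercuspidal, Prop. 13.1.3 (d)] — unguarded (vacuous where no packet is `unr`).  The per-place conjunct ★ `LawfulPacketKitAt`
of the FROZEN ★ `LawfulPacketKitU3` implies it (`lawfulPacketKitAtG_of_lawfulAt`). [cite: Rogawski1990, §13.1 Prop. 13.1.2 (a) p. 198, Prop. 13.1.3 (c) p. 199; §13.3 p. 203; §13.8 p. 216] -/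
def LawfulPacketKitAtG (v : HeightOneSpectrum (𝓞 ↥(maximalRealSubfield L))) (𝔨 : LocalPacketKit L (qsForm L) v) : Prop :=
  𝔨.CardLaw ∧ (Algebra.IsUnramifiedIn (𝓞 L) v.asIdeal → 𝔨.UnramLaw) ∧ ∀ (P P' : 𝔨.Pkt) (h : 𝔨.unr P), 𝔨.sph P h ∈ 𝔨.mem P' → P' = P

/-- **`LawfulPacketKitU3G L 𝔩` — HUR-guarded lawfulness of a kit family at every finite place** (the twin of ★ `LawfulPacketKitU3` with (ℓ4) demanded only at the places unramified in `L`).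
[cite: Rogawski1990, §13.1 Prop. 13.1.2 (a) p. 198, Prop. 13.1.3 (c) p. 199; §13.3 p. 201, p. 203; §13.8 p. 216] -/
def LawfulPacketKitU3G (𝔩 : ∀ v : HeightOneSpectrum (𝓞 ↥(maximalRealSubfield L)), LocalPacketKit L (qsForm L) v) : Prop :=
  ∀ v : HeightOneSpectrum (𝓞 ↥(maximalRealSubfield L)), LawfulPacketKitAtG L v (𝔩 v)

/-- Unfolding of `LawfulPacketKitAtG` (`Iff.rfl`). [cite: Rogawski1990, §13.1 Prop. 13.1.2 (a) p. 198, p. 199] -/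
theorem lawfulPacketKitAtG_iff (v : HeightOneSpectrum (𝓞 ↥(maximalRealSubfield L))) (𝔨 : LocalPacketKit L (qsForm L) v) :
    LawfulPacketKitAtG L v 𝔨 ↔
      𝔨.CardLaw ∧ (Algebra.IsUnramifiedIn (𝓞 L) v.asIdeal → 𝔨.UnramLaw) ∧ ∀ (P P' : 𝔨.Pkt) (h : 𝔨.unr P), 𝔨.sph P h ∈ 𝔨.mem P' → P' = P :=
  Iff.rfl

/-- Unfolding of `LawfulPacketKitU3G` (`Iff.rfl`): guarded lawfulness at every place. [cite: Rogawski1990, §13.1 Prop. 13.1.2 (a) p. 198, p. 199] -/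
theorem lawfulPacketKitU3G_iff (𝔩 : ∀ v : HeightOneSpectrum (𝓞 ↥(maximalRealSubfield L)), LocalPacketKit L (qsForm L) v) :
    LawfulPacketKitU3G L 𝔩 ↔ ∀ v : HeightOneSpectrum (𝓞 ↥(maximalRealSubfield L)),
      (𝔩 v).CardLaw ∧ (Algebra.IsUnramifiedIn (𝓞 L) v.asIdeal → (𝔩 v).UnramLaw) ∧
        ∀ (P P' : (𝔩 v).Pkt) (h : (𝔩 v).unr P), (𝔩 v).sph P h ∈ (𝔩 v).mem P' → P' = P :=
  Iff.rfl

variable {L}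

/-- **MONOTONICITY AT ONE PLACE**: the unguarded per-place conjunct ★ `LawfulPacketKitAt L v 𝔨` implies the guarded one (drop the guard's hypothesis) — so every ★ per-place lawfulness
result (e.g. ★ `lawfulAt_singletonKit` at split places) transfers for free. [cite: Rogawski1990, §13.1 p. 199; §13.3 p. 203] -/
theorem lawfulPacketKitAtG_of_lawfulAt {v : HeightOneSpectrum (𝓞 ↥(maximalRealSubfield L))} {𝔨 : LocalPacketKit L (qsForm L) v}
    (h : LawfulPacketKitAt L v 𝔨) : LawfulPacketKitAtG L v 𝔨 :=
  ⟨h.1, fun _ => h.2.1, h.2.2⟩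

/-- **MONOTONICITY**: ★ `LawfulPacketKitU3 L 𝔩 → LawfulPacketKitU3G L 𝔩` (the FROZEN unguarded notion implies the guarded twin). [cite: Rogawski1990, §13.1 p. 199; §13.3 p. 203] -/
theorem LawfulPacketKitU3.toG {𝔩 : ∀ v : HeightOneSpectrum (𝓞 ↥(maximalRealSubfield L)), LocalPacketKit L (qsForm L) v}
    (h : LawfulPacketKitU3 L 𝔩) : LawfulPacketKitU3G L 𝔩 :=
  fun v => ⟨(h v).1, fun _ => (h v).2.1, (h v).2.2⟩

/-- Guarded lawfulness from guarded lawfulness at every place (binder form). [cite: Rogawski1990, §13.1 p. 199] -/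
theorem lawfulPacketKitU3G_of_forall {𝔩 : ∀ v : HeightOneSpectrum (𝓞 ↥(maximalRealSubfield L)), LocalPacketKit L (qsForm L) v}
    (h : ∀ v, LawfulPacketKitAtG L v (𝔩 v)) : LawfulPacketKitU3G L 𝔩 :=
  h

/-- **(ℓ1) EXPORT**: the cardinality law at every place. [cite: Rogawski1990, §13.1 Prop. 13.1.2 (a) p. 198] -/
theorem LawfulPacketKitU3G.cardLaw {𝔩 : ∀ v : HeightOneSpectrum (𝓞 ↥(maximalRealSubfield L)), LocalPacketKit L (qsForm L) v}
    (h : LawfulPacketKitU3G L 𝔩) (v : HeightOneSpectrum (𝓞 ↥(maximalRealSubfield L))) : (𝔩 v).CardLaw :=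
  (h v).1

/-- **(ℓ4) EXPORT AT ONE PLACE UNDER THE GUARD** (T-A's (KG1′) reading `∀ v, Algebra.IsUnramifiedIn (𝓞 L) v.asIdeal → (𝔩 v).UnramLaw`, fed by `fun v => h.unramLaw v`).
[cite: Rogawski1990, §13.1 Prop. 13.1.3 (c) p. 199; §13.3 p. 203] -/
theorem LawfulPacketKitU3G.unramLaw {𝔩 : ∀ v : HeightOneSpectrum (𝓞 ↥(maximalRealSubfield L)), LocalPacketKit L (qsForm L) v}
    (h : LawfulPacketKitU3G L 𝔩) (v : HeightOneSpectrum (𝓞 ↥(maximalRealSubfield L))) (hur : Algebra.IsUnramifiedIn (𝓞 L) v.asIdeal) :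
    (𝔩 v).UnramLaw :=
  (h v).2.1 hur

/-- **(ℓ5) EXPORT**: the unramified member of an `unr` packet lies in no other packet, at every place (unguarded). [cite: Rogawski1990, §13.1 Prop. 13.1.3 (d), p. 199] -/
theorem LawfulPacketKitU3G.eq_of_sph_mem {𝔩 : ∀ v : HeightOneSpectrum (𝓞 ↥(maximalRealSubfield L)), LocalPacketKit L (qsForm L) v}
    (h : LawfulPacketKitU3G L 𝔩) (v : HeightOneSpectrum (𝓞 ↥(maximalRealSubfield L))) (P P' : (𝔩 v).Pkt) (hu : (𝔩 v).unr P)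
    (hin : (𝔩 v).sph P hu ∈ (𝔩 v).mem P') : P' = P :=
  (h v).2.2 P P' hu hin

/-- **(ℓ4) OFF A FINITE SET `S ⊇ Ram(L∕L⁺)`** (the letter shape of consumers that carry a finite `S` with `hS : ∀ v ∉ S, HUR v`, LEAD #37 (A) (d)). [cite: Rogawski1990, §13.3 p. 203; §13.8 p. 216] -/
theorem LawfulPacketKitU3G.unramLaw_of_not_mem {𝔩 : ∀ v : HeightOneSpectrum (𝓞 ↥(maximalRealSubfield L)), LocalPacketKit L (qsForm L) v}
    (h : LawfulPacketKitU3G L 𝔩) {S : Finset (HeightOneSpectrum (𝓞 ↥(maximalRealSubfield L)))}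
    (hS : ∀ v, v ∉ S → Algebra.IsUnramifiedIn (𝓞 L) v.asIdeal) (v : HeightOneSpectrum (𝓞 ↥(maximalRealSubfield L))) (hv : v ∉ S) :
    (𝔩 v).UnramLaw :=
  (h v).2.1 (hS v hv)

/-- **(ℓ4) AT ALMOST EVERY PLACE, BY NAME**: only finitely many places of `L⁺` ramify in `L` (★ `finite_setOf_not_isUnramifiedIn (↥(maximalRealSubfield L)) L`, via Mathlib
`differentIdeal_ne_bot` ∕ `Ideal.finite_factors`), so a guarded-lawful family satisfies ★ `UnramLaw` at cofinitely many `v` — print's «for almost all `v`».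
[cite: Rogawski1990, §13.3 p. 201, p. 203; §13.8 p. 216] -/
theorem LawfulPacketKitU3G.eventually_unramLaw {𝔩 : ∀ v : HeightOneSpectrum (𝓞 ↥(maximalRealSubfield L)), LocalPacketKit L (qsForm L) v}
    (h : LawfulPacketKitU3G L 𝔩) : ∀ᶠ v in Filter.cofinite, (𝔩 v).UnramLaw := by
  have hfin : ∀ᶠ v : HeightOneSpectrum (𝓞 ↥(maximalRealSubfield L)) in Filter.cofinite, Algebra.IsUnramifiedIn (𝓞 L) v.asIdeal := by
    rw [Filter.eventually_cofinite]
    exact finite_setOf_not_isUnramifiedIn (↥(maximalRealSubfield L)) L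
  exact hfin.mono fun v hv => (h v).2.1 hv

end Laws

/-! ## §2 The named print input over guarded kits: PACKET RIGIDITY + EXHAUSTION with a shared kit [Thm. 13.1.1; p. 199; p. 201 ¶2; Thm. 13.3.5; Thm. 13.3.6 (c)] -/

/-- **`PacketRigidityExhaustionAtG L` — for the CM field `L`: there is a HUR-GUARDED-LAWFUL packet kit family `𝔩 = (Π′(G_v))_v` on the quasi-split `U(Φ₃)` over `L⁺` such that, for every
automorphic measure `μ`:** EXHAUSTION — every family of local classes occurring in the discrete spectrum (★ `cmOccursInDiscreteSpectrum`) is a member of some global packet over `𝔩`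
[Thm. 13.1.1; p. 199; p. 201 ¶2; p. 203]; RIGIDITY — two DISCRETE global packets over `𝔩` agreeing at almost all finite places are EQUAL [Thm. 13.3.5 p. 202].  The body of ★
`PacketRigidityExhaustionAt` VERBATIM with `LawfulPacketKitU3G` for `LawfulPacketKitU3`; ★ `PacketRigidityExhaustionAt L` implies it (`PacketRigidityExhaustionAt.toG`).
[cite: Rogawski1990, §13.1 Thm. 13.1.1 p. 198, p. 199; §13.3 p. 201, Thm. 13.3.5 p. 202, Thm. 13.3.6 (c) p. 202, p. 203; §13.8 p. 216] [cite: FlathCorvallis1979, Thm. 3] -/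
def PacketRigidityExhaustionAtG (L : Type) [Field L] [NumberField L] [IsCMField L] : Prop :=
  ∃ 𝔩 : ∀ v : HeightOneSpectrum (𝓞 ↥(maximalRealSubfield L)), LocalPacketKit L (qsForm L) v,
    LawfulPacketKitU3G L 𝔩 ∧
      ∀ (μ : Measure (adelicGroupData (↥(maximalRealSubfield L)) L (IsCMField.complexConj L) 3 (qsForm L)).automorphicQuotient)
        [(adelicGroupData (↥(maximalRealSubfield L)) L (IsCMField.complexConj L) 3 (qsForm L)).IsAutomorphicMeasure μ],
        (∀ π : ∀ u : HeightOneSpectrum (𝓞 ↥(maximalRealSubfield L)), IrrClass (Gqs L u),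
            cmOccursInDiscreteSpectrum L 3 (qsForm L) μ π → ∃ Pg : GlobalPacket 𝔩, Pg.Mem π) ∧
          ∀ Pg Pg' : GlobalPacket 𝔩, Pg.IsDiscrete μ → Pg'.IsDiscrete μ →
            (∀ᶠ v in Filter.cofinite, Pg.loc v = Pg'.loc v) → Pg = Pg'

/-- **`PacketRigidityExhaustionU3G` — ROGAWSKI'S PACKET STRUCTURE OF THE DISCRETE SPECTRUM OF THE QUASI-SPLIT `U(3)` over HUR-guarded-lawful kits, as ONE named print input**: for
every CM field `L`, `PacketRigidityExhaustionAtG L`.  The deliverable behind the repaired socket `sig_K2E1RigidityFiniteU3R` (§3), with print's own scope on the unramified-member law.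
(print: Rogawski1990, §13.1 Thm. 13.1.1 p. 198, Prop. 13.1.3 (c) p. 199; §13.3 p. 201 ¶2, Thm. 13.3.5 p. 202, p. 203; §13.8 p. 216) (print: FlathCorvallis1979, Thm. 3) -/
def PacketRigidityExhaustionU3G : Prop :=
  ∀ (L : Type) [Field L] [NumberField L] [IsCMField L], PacketRigidityExhaustionAtG L

/-- Unfolding of `PacketRigidityExhaustionU3G` (`Iff.rfl`). [cite: Rogawski1990, §13.3 Thm. 13.3.5 p. 202] -/
theorem packetRigidityExhaustionU3G_iff :
    PacketRigidityExhaustionU3G ↔ ∀ (L : Type) [Field L] [NumberField L] [IsCMField L], PacketRigidityExhaustionAtG L :=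
  Iff.rfl

/-- Unfolding of `PacketRigidityExhaustionAtG` (`Iff.rfl`). [cite: Rogawski1990, §13.1 Thm. 13.1.1 p. 198; §13.3 Thm. 13.3.5 p. 202] -/
theorem packetRigidityExhaustionAtG_iff (L : Type) [Field L] [NumberField L] [IsCMField L] :
    PacketRigidityExhaustionAtG L ↔
      ∃ 𝔩 : ∀ v : HeightOneSpectrum (𝓞 ↥(maximalRealSubfield L)), LocalPacketKit L (qsForm L) v,
        LawfulPacketKitU3G L 𝔩 ∧
          ∀ (μ : Measure (adelicGroupData (↥(maximalRealSubfield L)) L (IsCMField.complexConj L) 3 (qsForm L)).automorphicQuotient)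
            [(adelicGroupData (↥(maximalRealSubfield L)) L (IsCMField.complexConj L) 3 (qsForm L)).IsAutomorphicMeasure μ],
            (∀ π : ∀ u : HeightOneSpectrum (𝓞 ↥(maximalRealSubfield L)), IrrClass (Gqs L u),
                cmOccursInDiscreteSpectrum L 3 (qsForm L) μ π → ∃ Pg : GlobalPacket 𝔩, Pg.Mem π) ∧
              ∀ Pg Pg' : GlobalPacket 𝔩, Pg.IsDiscrete μ → Pg'.IsDiscrete μ →
                (∀ᶠ v in Filter.cofinite, Pg.loc v = Pg'.loc v) → Pg = Pg' :=
  Iff.rfl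

/-- **MONOTONICITY**: ★ `PacketRigidityExhaustionAt L → PacketRigidityExhaustionAtG L` (same witness kit; its ★ lawfulness is guarded lawfulness by `LawfulPacketKitU3.toG`).
[cite: Rogawski1990, §13.1 Thm. 13.1.1 p. 198; §13.3 Thm. 13.3.5 p. 202] -/
theorem PacketRigidityExhaustionAt.toG {L : Type} [Field L] [NumberField L] [IsCMField L]
    (h : PacketRigidityExhaustionAt L) : PacketRigidityExhaustionAtG L := by
  obtain ⟨𝔩, hlaw, hμ⟩ := h
  exact ⟨𝔩, hlaw.toG, hμ⟩

/-- **MONOTONICITY, binder-less form**: ★ `PacketRigidityExhaustionU3 → PacketRigidityExhaustionU3G`. [cite: Rogawski1990, §13.3 Thm. 13.3.5 p. 202] -/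
theorem PacketRigidityExhaustionU3.toG (h : PacketRigidityExhaustionU3) : PacketRigidityExhaustionU3G :=
  fun L _ _ _ => (h L).toG

/-! ## §3 The repaired socket from the guarded named input [Thm. 13.3.5 + p. 199 ⇒ member-level rigidity ⇒ ★ counting layer] -/

variable {L : Type} [Field L] [NumberField L] [IsCMField L]

/-- **MEMBER-LEVEL RIGIDITY over a HUR-guarded-lawful rigid exhaustive kit** (THE ONE RE-CERT of ★ `memberRigidity_of_lawful_of_exhaustion_of_rigidity` under the weaker
`LawfulPacketKitU3G`): for an occurring `π ∈ Π`, every occurring `π′` agreeing with `π` off a finite `S` is a member of `Π` — at almost every `v` (two cofinite sets: `π′_v = π_v` off `S`,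
and the member's a.e.-`sph` set), `sph (Π.loc v) = π_v = π′_v ∈ mem (Π′.loc v)`, so `Π′.loc v = Π.loc v` by the UNGUARDED (ℓ5), whence `Π = Π′` by rigidity; (ℓ4) is not used.
[cite: Rogawski1990, §13.3 Thm. 13.3.5 p. 202; §13.1 p. 199; §13.3 p. 203] -/
theorem memberRigidity_of_lawfulG_of_exhaustion_of_rigidity
    {𝔩 : ∀ v : HeightOneSpectrum (𝓞 ↥(maximalRealSubfield L)), LocalPacketKit L (qsForm L) v} (hlaw : LawfulPacketKitU3G L 𝔩)
    (μ : Measure (adelicGroupData (↥(maximalRealSubfield L)) L (IsCMField.complexConj L) 3 (qsForm L)).automorphicQuotient)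
    [(adelicGroupData (↥(maximalRealSubfield L)) L (IsCMField.complexConj L) 3 (qsForm L)).IsAutomorphicMeasure μ]
    (hexh : ∀ π : ∀ u : HeightOneSpectrum (𝓞 ↥(maximalRealSubfield L)), IrrClass (Gqs L u),
      cmOccursInDiscreteSpectrum L 3 (qsForm L) μ π → ∃ Pg : GlobalPacket 𝔩, Pg.Mem π)
    (hrig : ∀ Pg Pg' : GlobalPacket 𝔩, Pg.IsDiscrete μ → Pg'.IsDiscrete μ → (∀ᶠ v in Filter.cofinite, Pg.loc v = Pg'.loc v) → Pg = Pg')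
    {π : ∀ u : HeightOneSpectrum (𝓞 ↥(maximalRealSubfield L)), IrrClass (Gqs L u)} {Pg : GlobalPacket 𝔩}
    (hπ : cmOccursInDiscreteSpectrum L 3 (qsForm L) μ π) (hmem : Pg.Mem π) (S : Finset (HeightOneSpectrum (𝓞 ↥(maximalRealSubfield L))))
    (π' : ∀ u : HeightOneSpectrum (𝓞 ↥(maximalRealSubfield L)), IrrClass (Gqs L u))
    (hπ' : cmOccursInDiscreteSpectrum L 3 (qsForm L) μ π') (hoff : ∀ u, u ∉ S → π' u = π u) : Pg.Mem π' := by
  obtain ⟨Pg', hmem'⟩ := hexh π' hπ'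
  -- the two packets agree at almost every place
  have hae : ∀ᶠ v in Filter.cofinite, Pg.loc v = Pg'.loc v := by
    have hoffev : ∀ᶠ v in Filter.cofinite, π' v = π v := by
      rw [Filter.eventually_cofinite]
      exact S.finite_toSet.subset (fun v hv => by
        by_contra hvS
        exact hv (hoff v hvS))
    filter_upwards [hmem.2, hoffev] with v hsph heq
    obtain ⟨h, hπv⟩ := hsph
    have hin : (𝔩 v).sph (Pg.loc v) h ∈ (𝔩 v).mem (Pg'.loc v) := by
      rw [← hπv, ← heq]
      exact hmem'.1 v
    exact ((hlaw v).2.2 (Pg.loc v) (Pg'.loc v) h hin).symm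
  have hPg : Pg = Pg' := hrig Pg Pg' ⟨π, hmem, hπ⟩ ⟨π', hmem', hπ'⟩ hae
  rw [hPg]
  exact hmem'

/-- **THE REPAIRED SOCKET `sig_K2E1RigidityFiniteU3R` FROM THE GUARDED NAMED PRINT INPUT** — `PacketRigidityExhaustionU3G → ‹socket bytes›` (conclusion = the type of
`sig_K2E1RigidityFiniteU3R`, `Cruxes/H413/Lines/K2_E1_TraceFormulaBetaSigs_GlobalIndex.lean` ED. 4 :213, VERBATIM with the organ's reducible abbrev `Pl L` inlined; = ★ :162's road over
§3): exhaustion puts the occurring `π` in a packet `Π`, member-level rigidity (`memberRigidity_of_lawfulG_of_exhaustion_of_rigidity`) puts every occurring `π′` agreeing with `π` off `S`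
in `Π`, and the counting layer ★ `finite_setOf_occurs_and_eqOff_of_memberRigidity` bounds them.  So #8R is ENGINE-TERMINAL MODULO `PacketRigidityExhaustionU3G`.
[cite: Rogawski1990, §13.3 Thm. 13.3.5 p. 202, p. 201; §13.1 Prop. 13.1.2 (a) p. 198, p. 199; §13.8 p. 216, p. 219] [cite: FlathCorvallis1979, Thm. 3] -/
theorem sig_K2E1RigidityFiniteU3R_of_packetRigidityExhaustionG (hPRE : PacketRigidityExhaustionU3G) :
    ∀ (L : Type) [Field L] [NumberField L] [IsCMField L]
      (μ : Measure (adelicGroupData (↥(maximalRealSubfield L)) L (IsCMField.complexConj L) 3 (qsForm L)).automorphicQuotient)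
      [(adelicGroupData (↥(maximalRealSubfield L)) L (IsCMField.complexConj L) 3 (qsForm L)).IsAutomorphicMeasure μ]
      (π : ∀ u : HeightOneSpectrum (𝓞 ↥(maximalRealSubfield L)), IrrClass (Gqs L u)), cmOccursInDiscreteSpectrum L 3 (qsForm L) μ π →
      ∀ S : Finset (HeightOneSpectrum (𝓞 ↥(maximalRealSubfield L))),
        {π' : ∀ u : HeightOneSpectrum (𝓞 ↥(maximalRealSubfield L)), IrrClass (Gqs L u) |
          cmOccursInDiscreteSpectrum L 3 (qsForm L) μ π' ∧ ∀ u : HeightOneSpectrum (𝓞 ↥(maximalRealSubfield L)), u ∉ S → π' u = π u}.Finite := by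
  intro L _ _ _ μ _ π hπ S
  obtain ⟨𝔩, hlaw, hμ⟩ := hPRE L
  obtain ⟨hexh, hrig⟩ := hμ μ
  obtain ⟨Pg, hmem⟩ := hexh π hπ
  exact finite_setOf_occurs_and_eqOff_of_memberRigidity μ π S Pg
    (memberRigidity_of_lawfulG_of_exhaustion_of_rigidity hlaw μ hexh hrig hπ hmem S)

/-- **THE FROZEN ROAD FACTORS THROUGH THE GUARDED ONE**: ★ `PacketRigidityExhaustionU3` still yields the socket, now via `PacketRigidityExhaustionU3.toG` (consistency check; the ★
theorem `sig_K2E1RigidityFiniteU3R_of_packetRigidityExhaustion` is untouched). [cite: Rogawski1990, §13.3 Thm. 13.3.5 p. 202] -/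
theorem sig_K2E1RigidityFiniteU3R_of_packetRigidityExhaustion_viaG (hPRE : PacketRigidityExhaustionU3) :
    ∀ (L : Type) [Field L] [NumberField L] [IsCMField L]
      (μ : Measure (adelicGroupData (↥(maximalRealSubfield L)) L (IsCMField.complexConj L) 3 (qsForm L)).automorphicQuotient)
      [(adelicGroupData (↥(maximalRealSubfield L)) L (IsCMField.complexConj L) 3 (qsForm L)).IsAutomorphicMeasure μ]
      (π : ∀ u : HeightOneSpectrum (𝓞 ↥(maximalRealSubfield L)), IrrClass (Gqs L u)), cmOccursInDiscreteSpectrum L 3 (qsForm L) μ π →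
      ∀ S : Finset (HeightOneSpectrum (𝓞 ↥(maximalRealSubfield L))),
        {π' : ∀ u : HeightOneSpectrum (𝓞 ↥(maximalRealSubfield L)), IrrClass (Gqs L u) |
          cmOccursInDiscreteSpectrum L 3 (qsForm L) μ π' ∧ ∀ u : HeightOneSpectrum (𝓞 ↥(maximalRealSubfield L)), u ∉ S → π' u = π u}.Finite :=
  sig_K2E1RigidityFiniteU3R_of_packetRigidityExhaustionG hPRE.toG

end Summit.HodgeConjecture.HodgeConjecture.Cruxes.H413.K2E1PacketRigidityU3

end
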